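import Mathlib
import HarnessLib
import Literature.Analysis.FluidPDE.LocalTypeICongr

/-!
# Route HardyPointSink — support `ABForwardHardy` (item stmt-NavierStokesRegularity-7983), file 7:
# passing pointwise bounds and the Hardy bound to strong `L³` limits

Seventh helper file for the forward direction of Albritton–Barker 2019, Thm. 1.1 carrying the
Hardy bound.  Along a sequence of fields converging strongly in `L³` on a parabolic ball a
subsequence converges almost everywhere (`exists_subseq_tendsto_ae`); hence uniform a.e. bounds
`‖v_k‖ ≤ B` pass to the limit (`ae_norm_le_of_tendsto_eLpNorm`; Seregin–Šverák 2009, (p8)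
"`sup |u| ≤ 1`" for the blow-up limit), and so does the **Hardy bound**
`∫_{B(0,R)} |v_k(s, y)|² |y − y₀|⁻¹ dy ≤ K` for a.e. `s` (`hardy_le_of_tendsto_eLpNorm`): for
a.e. time the slices converge a.e. along the subsequence, and Fatou's lemma applies to the
weighted integrals (the weight `|y − y₀|⁻¹` is finite off the null set `{y₀}`).  This is the
lower semicontinuity step of item stmt-NavierStokesRegularity-7983 ("`∫_{B_R}|u_k|²/|y−x₀|` is
lower semicontinuous under the strong `L³_loc` convergence of Lemma 2.2 (Fatou)").

## References

* D. Albritton, T. Barker, J. Math. Fluid Mech. 21 (2019) = arXiv:1811.00502, Lemma 2.2, §3.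
* G. Seregin, V. Šverák, Comm. PDE 34 (2009) = arXiv:0804.1803, §2 Thm. 2.8.
-/

noncomputable section

open MeasureTheory Set Function Filter Topology TopologicalSpace Metric
open scoped NNReal ENNReal
open Literature.Analysis Literature.Analysis.FluidPDE

-- single-problem summit: the namespace repeats the summit name by design (CONVENTIONS §1)
set_option linter.dupNamespace false

namespace Summit.NavierStokesRegularity.NavierStokesRegularity.Theorems.HardyPointSinkABForwardHardy

local notation "E³" => EuclideanSpace ℝ (Fin 3)

/-- **Strong `L³` convergence has an a.e. convergent subsequence.** -/
theorem exists_subseq_tendsto_ae {Q₀ : Set (ℝ × E³)} {v : ℕ → ℝ → E³ → E³} {U : ℝ → E³ → E³}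
    (hv : ∀ k, AEStronglyMeasurable (uncurry (v k)) (volume.restrict Q₀))
    (hU : AEStronglyMeasurable (uncurry U) (volume.restrict Q₀))
    (hconv : Tendsto (fun k => eLpNorm (uncurry (v k) - uncurry U) 3 (volume.restrict Q₀))
      atTop (𝓝 0)) :
    ∃ φ : ℕ → ℕ, StrictMono φ ∧ ∀ᵐ w ∂(volume.restrict Q₀),
      Tendsto (fun i => uncurry (v (φ i)) w) atTop (𝓝 (uncurry U w)) :=
  (tendstoInMeasure_of_tendsto_eLpNorm (by norm_num) hv hU hconv).exists_seq_tendsto_ae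

/-- **Uniform a.e. bounds pass to strong `L³` limits** (Seregin–Šverák 2009, (p8)). -/
theorem ae_norm_le_of_tendsto_eLpNorm {Q₀ : Set (ℝ × E³)} {v : ℕ → ℝ → E³ → E³}
    {U : ℝ → E³ → E³} {B : ℝ}
    (hv : ∀ k, AEStronglyMeasurable (uncurry (v k)) (volume.restrict Q₀))
    (hU : AEStronglyMeasurable (uncurry U) (volume.restrict Q₀))
    (hconv : Tendsto (fun k => eLpNorm (uncurry (v k) - uncurry U) 3 (volume.restrict Q₀))
      atTop (𝓝 0))
    (hbd : ∀ k, ∀ᵐ w ∂(volume.restrict Q₀), ‖uncurry (v k) w‖ ≤ B) :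
    ∀ᵐ w ∂(volume.restrict Q₀), ‖uncurry U w‖ ≤ B := by
  obtain ⟨φ, -, hae⟩ := exists_subseq_tendsto_ae hv hU hconv
  have hall : ∀ᵐ w ∂(volume.restrict Q₀), ∀ k, ‖uncurry (v k) w‖ ≤ B := ae_all_iff.2 hbd
  filter_upwards [hae, hall] with w hw hw'
  exact le_of_tendsto hw.norm (Eventually.of_forall fun i => hw' (φ i))

/-- `Q(0, R)` as the product `(-R², 0) × B(0, R)` at the level of restricted measures. -/
theorem volume_restrict_parabolicCylinder_zero (R : ℝ) :
    (volume.restrict (parabolicCylinder R (0 : ℝ × E³)) : Measure (ℝ × E³)) =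
      (volume.restrict (Ioo (-R ^ 2) 0)).prod (volume.restrict (ball (0 : E³) R)) := by
  have h := volume_restrict_parabolicCylinder_eq_prod' R (0 : ℝ × E³)
  rw [Prod.fst_zero, Prod.snd_zero, zero_sub] at h
  exact h

/-- **The Hardy bound passes to strong `L³` limits** (Fatou on a.e. time slices): if
`v_k → U` in `L³(Q(0, R))` and `∫_{B(0,R)} |v_k(s,y)|² |y − y₀|⁻¹ dy ≤ K` for a.e.
`s ∈ (-R², 0)` and every `k`, then the same holds for `U`. [cite: AlbrittonBarker2019, §3 (lower semicontinuity under Lemma 2.2)] -/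
theorem hardy_le_of_tendsto_eLpNorm {R : ℝ} {v : ℕ → ℝ → E³ → E³} {U : ℝ → E³ → E³}
    (hv : ∀ k, AEStronglyMeasurable (uncurry (v k))
      (volume.restrict (parabolicCylinder R (0 : ℝ × E³))))
    (hU : AEStronglyMeasurable (uncurry U) (volume.restrict (parabolicCylinder R (0 : ℝ × E³))))
    (hconv : Tendsto (fun k => eLpNorm (uncurry (v k) - uncurry U) 3
      (volume.restrict (parabolicCylinder R (0 : ℝ × E³)))) atTop (𝓝 0))
    {y₀ : E³} {K : ℝ≥0∞}
    (hbd : ∀ k, ∀ᵐ s ∂(volume.restrict (Ioo (-R ^ 2) 0)),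
      ∫⁻ y in ball (0 : E³) R, ‖v k s y‖ₑ ^ 2 / ‖y - y₀‖ₑ ≤ K) :
    ∀ᵐ s ∂(volume.restrict (Ioo (-R ^ 2) 0)),
      ∫⁻ y in ball (0 : E³) R, ‖U s y‖ₑ ^ 2 / ‖y - y₀‖ₑ ≤ K := by
  set I : Set ℝ := Ioo (-R ^ 2) 0 with hI
  set B : Set E³ := ball (0 : E³) R with hB
  obtain ⟨φ, -, hae⟩ := exists_subseq_tendsto_ae hv hU hconv
  have hprod := volume_restrict_parabolicCylinder_zero R
  have hae' : ∀ᵐ w ∂((volume.restrict I).prod (volume.restrict B)),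
      Tendsto (fun i => uncurry (v (φ i)) w) atTop (𝓝 (uncurry U w)) := by
    rw [← hprod]; exact hae
  have hvB : ∀ k, AEStronglyMeasurable (uncurry (v k))
      ((volume.restrict I).prod (volume.restrict B)) := fun k => by
    rw [← hprod]; exact hv k
  -- a.e. time slices: convergence and measurability
  have h1 : ∀ᵐ s ∂(volume.restrict I), ∀ᵐ y ∂(volume.restrict B),
      Tendsto (fun i => v (φ i) s y) atTop (𝓝 (U s y)) := Measure.ae_ae_of_ae_prod hae'
  have h2 : ∀ᵐ s ∂(volume.restrict I), ∀ k,
      AEStronglyMeasurable (fun y => v k s y) (volume.restrict B) := by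
    rw [ae_all_iff]
    intro k
    exact (hvB k).prodMk_left
  have h3 : ∀ᵐ s ∂(volume.restrict I), ∀ k,
      ∫⁻ y in B, ‖v k s y‖ₑ ^ 2 / ‖y - y₀‖ₑ ≤ K := ae_all_iff.2 hbd
  have hy₀ : ∀ᵐ y ∂(volume.restrict B), y ≠ y₀ := by
    refine ae_restrict_of_ae ?_
    have h0 : (volume : Measure E³) {y | ¬ y ≠ y₀} = 0 := by
      have e : {y : E³ | ¬ y ≠ y₀} = {y₀} := by ext y; simp
      rw [e]; exact measure_singleton y₀
    exact ae_iff.2 h0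
  filter_upwards [h1, h2, h3] with s hs hms hbs
  -- Fatou on the slice `s`
  have hfm : ∀ i, AEMeasurable (fun y => ‖v (φ i) s y‖ₑ ^ 2 / ‖y - y₀‖ₑ) (volume.restrict B) := by
    intro i
    have h1 : AEMeasurable (fun y => ‖v (φ i) s y‖ₑ ^ 2) (volume.restrict B) :=
      (hms (φ i)).aemeasurable.enorm.pow_const 2
    have h2 : AEMeasurable (fun y : E³ => (‖y - y₀‖ₑ)⁻¹) (volume.restrict B) :=
      (measurable_id.sub_const y₀).enorm.inv.aemeasurable
    simp_rw [div_eq_mul_inv]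
    exact h1.mul h2
  have hlim : ∀ᵐ y ∂(volume.restrict B),
      ‖U s y‖ₑ ^ 2 / ‖y - y₀‖ₑ = liminf (fun i => ‖v (φ i) s y‖ₑ ^ 2 / ‖y - y₀‖ₑ) atTop := by
    filter_upwards [hs, hy₀] with y hy hyy₀
    have ht : Tendsto (fun i => ‖v (φ i) s y‖ₑ ^ 2) atTop (𝓝 (‖U s y‖ₑ ^ 2)) :=
      ((ENNReal.continuous_pow 2).tendsto _).comp ((continuous_enorm.tendsto _).comp hy)
    have hne : (‖y - y₀‖ₑ)⁻¹ ≠ ∞ := ENNReal.inv_ne_top.2 (by simpa [sub_eq_zero] using hyy₀)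
    have ht' : Tendsto (fun i => ‖v (φ i) s y‖ₑ ^ 2 / ‖y - y₀‖ₑ) atTop
        (𝓝 (‖U s y‖ₑ ^ 2 / ‖y - y₀‖ₑ)) := by
      simp only [div_eq_mul_inv]
      exact ENNReal.Tendsto.mul_const ht (Or.inr hne)
    exact ht'.liminf_eq.symm
  calc ∫⁻ y in B, ‖U s y‖ₑ ^ 2 / ‖y - y₀‖ₑ
      = ∫⁻ y in B, liminf (fun i => ‖v (φ i) s y‖ₑ ^ 2 / ‖y - y₀‖ₑ) atTop :=
        lintegral_congr_ae hlim
    _ ≤ liminf (fun i => ∫⁻ y in B, ‖v (φ i) s y‖ₑ ^ 2 / ‖y - y₀‖ₑ) atTop := lintegral_liminf_le' hfm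
    _ ≤ limsup (fun i => ∫⁻ y in B, ‖v (φ i) s y‖ₑ ^ 2 / ‖y - y₀‖ₑ) atTop := liminf_le_limsup
    _ ≤ K := limsup_le_of_le (by isBoundedDefault) (Eventually.of_forall fun i => hbs (φ i))

end Summit.NavierStokesRegularity.NavierStokesRegularity.Theorems.HardyPointSinkABForwardHardy

end
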